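import Summits.HubbardSuperconductivity.HubbardLadder.Bounds.ThermalStrongCouplingStiffnessCeiling
import HarnessLib

/-!
# Hubbard ladder — Bounds: the thermal strong-coupling stiffness ceiling in the THERMODYNAMIC LIMIT
# (bounds.tex Thm 7_T(xv) = the `L → ∞` form of Thm 7_T(xiii); `t–t'` class, every filling `δ ≥ 0`)

HONEST FRAMING (cell pub-hubbard): ladder R1–R4 with certified numbers; no claim on H/H₀. This is a
bound for a MODEL CLASS — the `t–t'` Hubbard tori `hubbardTorusTT' L 1 t' U` on `(ℤ/Lℤ)²` along the
large even `L`, every real `t'`, every filling at or below half filling (`δ ≥ 0`), `U > 8(1 + |t'|)`,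
in the canonical `(N_L, S^z = 0)` Gibbs states at `β > 0`, for a stiffness DEFINED from the flux
response of the sector free energy — and no materials claim. Companion text:
`pub-hubbard/paper/bounds.tex` §7 (Theorem 7_T, proof of Corollary 7.2); tables
`pub-hubbard/pub-hubbard-bounds/BOUNDS.md` §3 (item 'Thm 7_T (a) Lean TL form', closed by this file).

## What is proved (no `sorry`, no new axioms; `τ := 1 + |t'|`, `τ₂ := 1 + 2|t'|`, `c := 2 + 2ω⁻¹`)

* `le_of_forall_large_even_sq` — the public form of the elementary limit step used (privately) by
  `StrongCouplingStiffnessCeiling.lean` and `StrongCouplingStiffnessCeilingTPrime.lean`: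
  `ρ ≤ A + B/L²` along all large even `L ≥ 3` gives `ρ ≤ A`.
* `ThermalStrongCouplingStiffnessCeilingTT'TL` / `…_holds` — **Thm 7_T(xv)**: if ONE `ρ_s > 0` is a
  thermal flux stiffness (`β ρ_s θ² ≤ log Z_p(0) - log Z_p(θ)` on `|θ| ≤ θ₀`, same `β, θ₀`) of the
  `(N_L, S^z = 0)` sectors for all large even `L`, then
  `ρ_s ≤ τ₂(δ + ω + c(4τδ + 32τ²/(U₁ - 8τ) + (log 4)/β)/(U - U₁))` for every `8τ < U₁ < U`, `ω > 0`:
  the landed finite-volume Thm 7_T(xiii) (`ThermalStrongCouplingStiffnessCeilingTT'Log4`) with the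
  hole density `n_h = holeDensity L δ ≤ δ + 2/L²` (`holeDensity_bounds`) and `L → ∞`. This is exactly
  the input of the paper proof of the NK₂-conditional Corollary 7.2; the `T → 0` companion is the
  landed `StrongCouplingStiffnessCeilingTT'TL` (Thm 7(ix)).

Honest size: paper-trivial (monotonicity in `n_h` and `2/L² → 0`); it adds no new estimate, it only
puts the `T > 0` doped Mott-proximity ceiling in the same thermodynamic-limit form as its `T = 0`
companions. Repulsive class; zero kit; standard axioms.
References (keys of `lean/references.bib`): Nagaoka1966 §II; HazraVermaRanderia2019 §III, App. G;
Tasaki2020 §2.1.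
-/

noncomputable section

namespace Summit.HubbardSuperconductivity.HubbardLadder.Bounds

open Matrix Finset Real
open Literature.MathematicalPhysics.QuantumLattice
open Literature.MathematicalPhysics.QuantumFieldTheory
open Literature.Probability.LatticeModels
open Literature.MathematicalPhysics.QuantumLattice.ThermodynamicLimit
open scoped ComplexOrder ComplexConjugate

/-! ### The elementary limit step (public) -/

/-- A bound `ρ ≤ A + B/L²` along all large even `L ≥ 3` gives `ρ ≤ A` (public form of the private
helpers of `StrongCouplingStiffnessCeiling.lean` / `StrongCouplingStiffnessCeilingTPrime.lean`). -/
theorem le_of_forall_large_even_sq {ρ A B : ℝ} (L₀ : ℕ)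
    (h : ∀ L : ℕ, L₀ ≤ L → 3 ≤ L → Even L → ρ ≤ A + B / (L : ℝ) ^ 2) : ρ ≤ A := by
  refine le_of_forall_pos_lt_add fun ε hε => ?_
  obtain ⟨m, hm⟩ := exists_nat_gt (B / ε)
  set L : ℕ := 2 * (m + L₀ + 3) with hLdef
  have hmL : (m : ℝ) ≤ (L : ℝ) ^ 2 := by
    have h1 : (m : ℝ) ≤ L := by rw [hLdef]; push_cast; linarith [(Nat.cast_nonneg L₀ : (0:ℝ) ≤ L₀)]
    have h2 : (1 : ℝ) ≤ L := by rw [hLdef]; push_cast; linarith [(Nat.cast_nonneg m : (0:ℝ) ≤ m),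
      (Nat.cast_nonneg L₀ : (0:ℝ) ≤ L₀)]
    nlinarith
  have hL2 : (0 : ℝ) < (L : ℝ) ^ 2 := by positivity
  have hBL : B / (L : ℝ) ^ 2 < ε := by
    rw [div_lt_iff₀ hL2]
    rw [div_lt_iff₀ hε] at hm
    nlinarith
  have := h L (by omega) (by omega) ⟨m + L₀ + 3, by omega⟩
  linarith

/-! ### Thm 7_T(xv) — thermodynamic-limit form of Thm 7_T(xiii) -/

/-- **Thm 7_T(xv) (thermal strong-coupling stiffness ceiling, `t–t'` class, thermodynamic limit;
PROVED below).** Any real `t'`, `τ := 1 + |t'|`, `0 ≤ δ`, `8τ < U₁ < U`, `β, ρ_s, θ₀, ω > 0`; if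
`ρ_s` is a thermal flux stiffness of the `(N_L, S^z = 0)` coordinate sector `p` of
`hubbardTorusTT' L 1 t' U` (`β ρ_s θ² ≤ log Z_p(0) - log Z_p(θ)` for `|θ| ≤ θ₀`) for ALL large even `L`
(same `ρ_s, θ₀, β`), then
`ρ_s ≤ (1 + 2|t'|)(δ + ω + (2 + 2ω⁻¹)(4τδ + 32τ²/(U₁ - 8τ) + (log 4)/β)/(U - U₁))`.
kind: support (PROVED). Why it might fail: it cannot. Sources: Nagaoka1966 §II; HazraVermaRanderia2019
§III, App. G; this cell (Thm 7_T(xiii), Thm 7(ix)). -/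
@[conjecture] def ThermalStrongCouplingStiffnessCeilingTT'TL : Prop :=
  ∀ (t' U U₁ δ β ρs θ₀ ω : ℝ) (L₀ : ℕ), 0 ≤ δ → 8 * (1 + |t'|) < U₁ → U₁ < U → 0 < β → 0 < ρs →
    0 < θ₀ → 0 < ω →
    (∀ (L : ℕ) [NeZero L], L₀ ≤ L → Even L →
      let p : Finset (Orb (FermionTorus 2 L)) → Prop := fun s =>
        s.card = 2 * ⌊(1 - δ) * (L : ℝ) ^ 2 / 2⌋₊ ∧
          2 * (s.filter fun i => (ofLex i).2 = 0).card = 2 * ⌊(1 - δ) * (L : ℝ) ^ 2 / 2⌋₊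
      ∀ θ : ℝ, |θ| ≤ θ₀ → β * ρs * θ ^ 2 ≤
        Real.log (partitionFn β ((hubbardTorusTT'Flux L t' U 0).toBlock p p)).re -
          Real.log (partitionFn β ((hubbardTorusTT'Flux L t' U θ).toBlock p p)).re) →
    ρs ≤ (1 + 2 * |t'|) * (δ + ω + (2 + 2 * ω⁻¹) *
      ((4 * (1 + |t'|) * δ + 32 * (1 + |t'|) ^ 2 / (U₁ - 8 * (1 + |t'|)) + Real.log 4 / β) /
        (U - U₁)))

/-- **Proof of `ThermalStrongCouplingStiffnessCeilingTT'TL`**: Thm 7_T(xiii)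
(`thermalStrongCouplingStiffnessCeilingTT'Log4_holds`) at every large even `L` with `n_h ≤ δ + 2/L²`
(`holeDensity_bounds`), then `L → ∞` (`le_of_forall_large_even_sq`). -/
theorem thermalStrongCouplingStiffnessCeilingTT'TL_holds :
    ThermalStrongCouplingStiffnessCeilingTT'TL := by
  intro t' U U₁ δ β ρs θ₀ ω L₀ hδ hU₁8 hU₁ hβ hρs hθ₀ hω hst
  set c : ℝ := 2 + 2 * ω⁻¹ with hc_def
  set τ : ℝ := 1 + |t'| with hτ_def
  set a : ℝ := 1 + 2 * |t'| with ha_def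
  set ℓ : ℝ := Real.log 4 / β with hℓ_def
  have hc : 0 ≤ c := by positivity
  have hτ : 0 ≤ τ := by positivity
  have ha : 0 ≤ a := by positivity
  have hW : 0 < U - U₁ := sub_pos.2 hU₁
  refine le_of_forall_large_even_sq (B := a * (2 * (1 + c * (4 * τ / (U - U₁))))) L₀
    fun L hL₀ hL3 hLe => ?_
  haveI : NeZero L := ⟨by omega⟩
  have h := thermalStrongCouplingStiffnessCeilingTT'Log4_holds L hL3 t' U U₁ δ β ρs θ₀ ω hδ hU₁8
    hU₁ hβ hρs hθ₀ hω (hst L hL₀ hLe)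
  rw [← hc_def, ← hτ_def, ← ha_def, ← hℓ_def] at h
  obtain ⟨-, -, hnh⟩ := holeDensity_bounds hδ L
  have hL2 : (0 : ℝ) < (L : ℝ) ^ 2 := by positivity
  have hmono : a * (holeDensity L δ + ω + c * ((4 * τ * holeDensity L δ +
      32 * τ ^ 2 / (U₁ - 8 * τ) + ℓ) / (U - U₁))) ≤ a * (δ + 2 / (L : ℝ) ^ 2 + ω +
      c * ((4 * τ * (δ + 2 / (L : ℝ) ^ 2) + 32 * τ ^ 2 / (U₁ - 8 * τ) + ℓ) / (U - U₁))) := by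
    refine mul_le_mul_of_nonneg_left ?_ ha
    have : c * ((4 * τ * holeDensity L δ + 32 * τ ^ 2 / (U₁ - 8 * τ) + ℓ) / (U - U₁)) ≤
        c * ((4 * τ * (δ + 2 / (L : ℝ) ^ 2) + 32 * τ ^ 2 / (U₁ - 8 * τ) + ℓ) / (U - U₁)) :=
      mul_le_mul_of_nonneg_left (div_le_div_of_nonneg_right (by nlinarith) hW.le) hc
    linarith
  have key : a * (δ + 2 / (L : ℝ) ^ 2 + ω +
      c * ((4 * τ * (δ + 2 / (L : ℝ) ^ 2) + 32 * τ ^ 2 / (U₁ - 8 * τ) + ℓ) / (U - U₁))) =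
      a * (δ + ω + c * ((4 * τ * δ + 32 * τ ^ 2 / (U₁ - 8 * τ) + ℓ) / (U - U₁))) +
        a * (2 * (1 + c * (4 * τ / (U - U₁)))) / (L : ℝ) ^ 2 := by
    field_simp
    ring
  linarith

end Summit.HubbardSuperconductivity.HubbardLadder.Bounds
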